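import Summits.HodgeConjecture.HodgeConjecture.Theorems.F0P2wPartialDedekindZetaPole
import HarnessLib

/-!
# FLOOR-0 P2, ROAD-W organ «W4-POLE» (B): the theta-shape partial `L`-function factorises as
# `ζ_K^S(s − ½) · ζ_K^S(s + ½) · L^S(s, c)` and has a SIMPLE POLE at `s = 3/2`

(ORGAN W4-POLE (B) of ROAD-W v1 239b1f58, step W4 POLE; F0P2-p01 (g20), 2026-09-02; desk F0P3-plan (g16) routing #1 (2)
«take (B) = L6»; per-place algebra of §1 typed GREEN first by F0P2-p02 (g18) (`ThetaShapeEulerFactor.alg.GREEN…`, pasted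
with credit).)  THEOREMS ONLY (no definition, no instance, no named fact, no `sorry`); inputs BY NAME: ★ `partialStandardL`,
★ `eulerPolynomial`, and (A) ★ `F0P2wPartialDedekindZetaPole` (partial Dedekind zeta away from a thin `S`: `HasProd`,
`= dedekindZetaCont · E_S`, removable singularity of `(s − 1)·ζ_K^S`, residue `≠ 0`, Landau non-vanishing).

THE STATEMENT (ROAD-W W4 «`L^S(s, π × μ′⁻¹) = ζ_F^S(s − ½) ζ_F^S(s + ½) L^S(s, ημ′⁻¹)` has a SIMPLE POLE at `s₀ = 3/2 =
n/2`; the places of degree `≥ 2` are thin and may stay unknown»).  `K` a number field, `S` a set of finite places THIN at an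
exponent `σ₀ ∈ [1/2, 1)` (`Summable (fun v : S => (q_v : ℝ) ^ (-σ₀))` — finite `S`, or `S ⊆ S₀ ∪ {residue degree ≥ 2}`,
`S₀` finite, by (A) §5), `α` a Satake family which off `S` has the THETA SHAPE `α v = {√q_v, (√q_v)⁻¹, c_v}` with
`‖c_v‖ ≤ 1` (the output of ★ L2 `F0P2wThetaShapeOfWeight.thetaShape_of_weight` after the twist by `u⁻¹`, ROAD-W W3).  Then
* §2 for `re s > 3/2`: the Euler product `∏'_{v ∉ S} (∏_{a ∈ α v}(1 − a q_v^{-s}))⁻¹` converges (`HasProd`) and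
  **`L^S(s, α) = ζ_K^S(s − ½) · ζ_K^S(s + ½) · L^S(s, c) ≠ 0`** (`hasProd_thetaPartialL`, `thetaPartialL_eq_mul`), all
  three factors written with ★ `partialStandardL` (`ζ_K^S = partialStandardL S (fun _ => {1})`);
* §3 **SIMPLE POLE AT `3/2`**: `∃ G` holomorphic on `{s | σ₀ + ½ < re s} ∋ 3/2` with `G(3/2) ≠ 0` and
  `(s − 3/2) · L^S(s, α) = G(s)` for `re s > 3/2` (`exists_differentiableOn_sub_mul_thetaPartialL_eq`) — so `L^S(·, α)`
  continues meromorphically to `re s > σ₀ + ½` with exactly a simple pole at `3/2` there (`G/(s − 3/2)`); and the `Tendsto`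
  reading `(s − 3/2) L^S(s, α) → r ≠ 0` on `𝓝[re s > 3/2] (3/2)` (`tendsto_sub_mul_thetaPartialL`), with
  `r = ρ_K · E_S(1) · ζ_K^S(2) · L^S(3/2, c)`, `ρ_K = dedekindZeta_residue K`, `E_S(t) = ∏'_{v ∈ S}(1 − q_v^{-t})`.
The pole comes from `ζ_K(s − ½)` (Hecke + class number formula, PROVED in the tree and packaged in (A)); `ζ_K^S(s + ½)` and
`L^S(s, c)` are holomorphic and non-zero near `3/2` (absolutely convergent Euler products, (A) §3).  HONEST NOTE (chair F0P2-ref1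
r389): here the places of UNKNOWN shape are REMOVED from the Euler product (they sit in `S`, which may be infinite but thin), so no
parameter bound at them is needed or claimed; KEEPING them in the product (finite `S₀`, `‖a‖ ≤ q_v^θ` with `θ < 1` at the places of
degree `≥ 2` — the trivial unitary bound `θ = 1` does not reach `3/2`) is the corollary of §3 with ★ p851123
`exists_eq_sub_mul_partialStandardL_of_degOne` (F0P2-p02 (g18), «L6-θ»), not this file.

Sources (reader's; kernel inputs are the ★ names): Liu, *Invent. math.* (2021) App. (ss:pole) Thm. 8.4 (1)(a) (the pole
hypothesis this organ produces for `n = 3`, `s₀ = n/2`), ROAD-W v1 §2 W4, §3(a); Neukirch *ANT* VII Cor. (5.11); Jacquet–Shalika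
(1981) §5 Thm. (5.3).  Parked under `Theorems/` (ruling (α), PLAN-P2 v18 add. 1): generic, upstream candidate.
Cell hodgecm-mathlib (D-0151), FLOOR 0, crux item H413 = stmt-HodgeConjecture-24833; lane `--kind proof --supports
stmt-HodgeConjecture-24833 --as helper`; touches no registry and no served Line.  HONEST LABEL: HC_CM is proved only modulo
the printed citations until rung 0 closes; this file proves nothing about them. [folklore]
-/

set_option autoImplicit false
set_option linter.dupNamespace false -- the mandated namespace repeats `HodgeConjecture.HodgeConjecture`

noncomputable section

open Filter Topology Complex NumberField IsDedekindDomain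
open Literature.NumberTheory.Automorphic Literature.NumberTheory.LFunctions

namespace Summit.HodgeConjecture.HodgeConjecture.Cruxes.H413.F0P2wThetaPartialLPole

open Summit.HodgeConjecture.HodgeConjecture.Cruxes.H413.F0P2wPartialDedekindZetaPole

variable {K : Type} [Field K] [NumberField K]

/-! ## §1 One place: the Euler factor of the theta shape `{√q, (√q)⁻¹, c}` -/

/-- `√q · q^{-s} = q^{-(s − 1/2)}` (`q ≠ 0`).  (Per-place algebra typed GREEN by F0P2-p02 (g18),
`F0/P2/p02/g18/ThetaShapeEulerFactor.alg.GREEN.F0P2p02g18.lean`, pasted with credit.) [folklore] -/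
theorem sqrt_mul_natCast_cpow_neg {q : ℕ} (hq : q ≠ 0) (s : ℂ) :
    ((Real.sqrt q : ℝ) : ℂ) * (q : ℂ) ^ (-s) = (q : ℂ) ^ (-(s - 1 / 2)) := by
  have hq0 : (q : ℂ) ≠ 0 := Nat.cast_ne_zero.mpr hq
  have hsqrt : ((Real.sqrt q : ℝ) : ℂ) = (q : ℂ) ^ ((1 / 2 : ℂ)) := by
    rw [Real.sqrt_eq_rpow, Complex.ofReal_cpow (Nat.cast_nonneg q), Complex.ofReal_natCast]
    norm_num
  rw [hsqrt, ← cpow_add _ _ hq0]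
  congr 1
  ring

/-- `(√q)⁻¹ · q^{-s} = q^{-(s + 1/2)}` (`q ≠ 0`; F0P2-p02 (g18), pasted with credit). [folklore] -/
theorem sqrt_inv_mul_natCast_cpow_neg {q : ℕ} (hq : q ≠ 0) (s : ℂ) :
    ((Real.sqrt q : ℝ) : ℂ)⁻¹ * (q : ℂ) ^ (-s) = (q : ℂ) ^ (-(s + 1 / 2)) := by
  have hq0 : (q : ℂ) ≠ 0 := Nat.cast_ne_zero.mpr hq
  have hsqrt : ((Real.sqrt q : ℝ) : ℂ)⁻¹ = (q : ℂ) ^ (-(1 / 2 : ℂ)) := by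
    rw [Real.sqrt_eq_rpow, Complex.ofReal_cpow (Nat.cast_nonneg q), Complex.ofReal_natCast,
      cpow_neg]
    norm_num
  rw [hsqrt, ← cpow_add _ _ hq0]
  congr 1
  ring

/-- **The Euler factor of the theta shape.**  For `q = q_v` and any `c`:
`∏_{a ∈ {√q, (√q)⁻¹, c}} (1 − a q^{-s}) = (1 − q^{-(s−½)}) · (1 − q^{-(s+½)}) · (1 − c q^{-s})` — the local factors of
`ζ_v(s − ½) ζ_v(s + ½) L_v(s, c)` (ROAD-W W4; cf. F0P2-p02 (g18) `eval_eulerPolynomial_thetaShape`, cons form). [folklore] -/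
theorem eval_eulerPolynomial_thetaShape (v : HeightOneSpectrum (𝓞 K)) (c s : ℂ) :
    (eulerPolynomial {((Real.sqrt v.residueCard : ℝ) : ℂ), ((Real.sqrt v.residueCard : ℝ) : ℂ)⁻¹, c}).eval
        ((v.residueCard : ℂ) ^ (-s)) =
      (1 - (v.residueCard : ℂ) ^ (-(s - 1 / 2))) * ((1 - (v.residueCard : ℂ) ^ (-(s + 1 / 2))) *
        (1 - c * (v.residueCard : ℂ) ^ (-s))) := by
  have hq : v.residueCard ≠ 0 := (zero_lt_one.trans v.one_lt_residueCard).ne'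
  rw [Multiset.insert_eq_cons, Multiset.insert_eq_cons, eval_eulerPolynomial, Multiset.map_cons,
    Multiset.prod_cons, Multiset.map_cons, Multiset.prod_cons, Multiset.map_singleton, Multiset.prod_singleton,
    sqrt_mul_natCast_cpow_neg hq, sqrt_inv_mul_natCast_cpow_neg hq]

/-- `re (s − ½) = re s − ½` and `re (s + ½) = re s + ½` (bookkeeping). [folklore] -/
theorem re_sub_half_re_add_half (s : ℂ) : (s - 1 / 2).re = s.re - 1 / 2 ∧ (s + 1 / 2).re = s.re + 1 / 2 := by
  constructor <;> simp

/-! ## §2 The factorisation `L^S(s, α) = ζ_K^S(s − ½) · ζ_K^S(s + ½) · L^S(s, c)` on `re s > 3/2` -/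

section Factorisation

variable {S : Set (HeightOneSpectrum (𝓞 K))} {α : SatakeFamily K} {c : HeightOneSpectrum (𝓞 K) → ℂ}

/-- **`HasProd` of the theta-shape Euler product on `re s > 3/2`.**  If off `S` the Satake family is
`α v = {√q_v, (√q_v)⁻¹, c_v}` with `‖c_v‖ ≤ 1`, then for `re s > 3/2` the Euler product
`∏'_{v ∉ S} (∏_{a ∈ α v} (1 − a q_v^{-s}))⁻¹` converges to `ζ_K^S(s − ½) · ζ_K^S(s + ½) · L^S(s, c)`, the three factors
being the `HasProd`-values of (A) §3 at `s − ½` (`re > 1`), `s + ½`, `s` (Mathlib `HasProd.mul`). [folklore] -/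
theorem hasProd_thetaPartialL (hc : ∀ v, v ∉ S → ‖c v‖ ≤ 1)
    (hα : ∀ v, v ∉ S → α v = {((Real.sqrt v.residueCard : ℝ) : ℂ), ((Real.sqrt v.residueCard : ℝ) : ℂ)⁻¹, c v})
    {s : ℂ} (hs : 3 / 2 < s.re) :
    HasProd (fun v : {v : HeightOneSpectrum (𝓞 K) // v ∉ S} =>
        ((eulerPolynomial (α v.1)).eval ((v.1.residueCard : ℂ) ^ (-s)))⁻¹)
      (partialStandardL S (fun _ => {1}) (s - 1 / 2) * partialStandardL S (fun _ => {1}) (s + 1 / 2) *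
        partialStandardL S (fun v => {c v}) s) := by
  have h1 := (hasProd_partialDedekindZeta (S := S) (s := s - 1 / 2)
    (by rw [(re_sub_half_re_add_half s).1]; linarith)).1
  have h2 := (hasProd_partialDedekindZeta (S := S) (s := s + 1 / 2)
    (by rw [(re_sub_half_re_add_half s).2]; linarith)).1
  have h3 := (hasProd_partialStandardL_singleton (S := S) c hc (s := s) (by linarith)).1
  refine ((h1.mul h2).mul h3).congr_fun fun v => ?_
  rw [hα v.1 v.2, eval_eulerPolynomial_thetaShape, mul_inv, mul_inv, mul_assoc]

/-- **FACTORISATION `L^S(s, α) = ζ_K^S(s − ½) · ζ_K^S(s + ½) · L^S(s, c)` for `re s > 3/2`**, all three written with ★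
`partialStandardL` (`ζ_K^S = partialStandardL S (fun _ => {1})`, `L^S(·, c) = partialStandardL S (v ↦ {c_v})`) — ROAD-W W4
«`L^S(s, π × μ′⁻¹) = ζ_F^S(s − ½) ζ_F^S(s + ½) L^S(s, ημ′⁻¹)`». [folklore] -/
theorem thetaPartialL_eq_mul (hc : ∀ v, v ∉ S → ‖c v‖ ≤ 1)
    (hα : ∀ v, v ∉ S → α v = {((Real.sqrt v.residueCard : ℝ) : ℂ), ((Real.sqrt v.residueCard : ℝ) : ℂ)⁻¹, c v})
    {s : ℂ} (hs : 3 / 2 < s.re) :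
    partialStandardL S α s =
      partialStandardL S (fun _ => {1}) (s - 1 / 2) * partialStandardL S (fun _ => {1}) (s + 1 / 2) *
        partialStandardL S (fun v => {c v}) s :=
  (hasProd_thetaPartialL hc hα hs).tprod_eq

/-- `L^S(s, α) ≠ 0` for `re s > 3/2` (each factor is non-zero by (A) §3). [folklore] -/
theorem thetaPartialL_ne_zero (hc : ∀ v, v ∉ S → ‖c v‖ ≤ 1)
    (hα : ∀ v, v ∉ S → α v = {((Real.sqrt v.residueCard : ℝ) : ℂ), ((Real.sqrt v.residueCard : ℝ) : ℂ)⁻¹, c v})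
    {s : ℂ} (hs : 3 / 2 < s.re) : partialStandardL S α s ≠ 0 := by
  rw [thetaPartialL_eq_mul hc hα hs]
  refine mul_ne_zero (mul_ne_zero ?_ ?_) ?_
  · exact (hasProd_partialDedekindZeta (S := S) (by rw [(re_sub_half_re_add_half s).1]; linarith)).2
  · exact (hasProd_partialDedekindZeta (S := S) (by rw [(re_sub_half_re_add_half s).2]; linarith)).2
  · exact (hasProd_partialStandardL_singleton (S := S) c hc (by linarith)).2

end Factorisation

/-! ## §3 The simple pole at `s = 3/2` (thin `S`) -/

section Pole

variable {S : Set (HeightOneSpectrum (𝓞 K))} {σ₀ : ℝ} {α : SatakeFamily K} {c : HeightOneSpectrum (𝓞 K) → ℂ}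

/-- **THE THETA-SHAPE PARTIAL `L`-FUNCTION HAS A SIMPLE POLE AT `s = 3/2`** (ROAD-W W4 POLE).  Let `S` be thin at an
exponent `σ₀ ∈ [1/2, 1)` (`Summable (fun v : S => (q_v : ℝ) ^ (-σ₀))`: finite `S`, or `S ⊆ S₀ ∪ {residue degree ≥ 2}`
with `S₀` finite — (A) §5) and let `α v = {√q_v, (√q_v)⁻¹, c_v}`, `‖c_v‖ ≤ 1` off `S`.  Then there is `G`, HOLOMORPHIC on
the half-plane `re s > σ₀ + ½` (which contains `3/2`), with `G(3/2) ≠ 0` and `(s − 3/2) · L^S(s, α) = G(s)` for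
`re s > 3/2`: i.e. `L^S(s, α) = G(s)/(s − 3/2)` continues meromorphically to `re s > σ₀ + ½` with a simple pole at `3/2`.
`G(s) = [(t − 1) ζ_K(t) E_S(t)]_{t = s − ½, extended by ρ_K E_S(1)} · ζ_K(s + ½) E_S(s + ½) · L^S(s, c)` from (A) §4:
`differentiableOn_update_sub_one_mul`, `differentiableOn_dedekindZetaCont_mul_thinEulerFactor`,
`residue_mul_thinEulerFactor_ne_zero`, `dedekindZetaCont_mul_thinEulerFactor_ne_zero_of_one_lt_re`, and §3
`partialDedekindZeta_eq_dedekindZetaCont_mul`, `hasProd_partialStandardL_singleton`,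
`differentiableOn_partialStandardL_singleton`.  [folklore] -/
theorem exists_differentiableOn_sub_mul_thetaPartialL_eq
    (hS : Summable fun v : S => ((v : HeightOneSpectrum (𝓞 K)).residueCard : ℝ) ^ (-σ₀))
    (hσ₀ : 1 / 2 ≤ σ₀) (hσ₁ : σ₀ < 1) (hc : ∀ v, v ∉ S → ‖c v‖ ≤ 1)
    (hα : ∀ v, v ∉ S → α v = {((Real.sqrt v.residueCard : ℝ) : ℂ), ((Real.sqrt v.residueCard : ℝ) : ℂ)⁻¹, c v}) :
    ∃ G : ℂ → ℂ, DifferentiableOn ℂ G {s : ℂ | σ₀ + 1 / 2 < s.re} ∧ G (3 / 2) ≠ 0 ∧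
      ∀ s : ℂ, 3 / 2 < s.re → (s - 3 / 2) * partialStandardL S α s = G s := by
  -- the three factors of `G`
  set r : ℂ := (dedekindZeta_residue K : ℂ) *
    ∏' v : S, (1 - ((v : HeightOneSpectrum (𝓞 K)).residueCard : ℂ) ^ (-(1 : ℂ))) with hr
  set G₁ : ℂ → ℂ := Function.update (fun t : ℂ => (t - 1) *
    (dedekindZetaCont K t * ∏' v : S, (1 - ((v : HeightOneSpectrum (𝓞 K)).residueCard : ℂ) ^ (-t)))) 1 r with hG₁
  set G₂ : ℂ → ℂ := fun t : ℂ =>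
    dedekindZetaCont K t * ∏' v : S, (1 - ((v : HeightOneSpectrum (𝓞 K)).residueCard : ℂ) ^ (-t)) with hG₂
  set G₃ : ℂ → ℂ := partialStandardL S (fun v => {c v}) with hG₃
  set U : Set ℂ := {s : ℂ | σ₀ + 1 / 2 < s.re} with hU
  have hre : ∀ s ∈ U, σ₀ < (s - 1 / 2).re ∧ σ₀ < (s + 1 / 2).re ∧ 1 < (s + 1 / 2).re ∧ 1 < s.re := by
    intro s hs
    have hs' : σ₀ + 1 / 2 < s.re := hs
    rw [(re_sub_half_re_add_half s).1, (re_sub_half_re_add_half s).2]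
    refine ⟨by linarith, by linarith, by linarith, by linarith⟩
  refine ⟨fun s => G₁ (s - 1 / 2) * G₂ (s + 1 / 2) * G₃ s, ?_, ?_, ?_⟩
  · -- holomorphy on `U`
    have h1 : DifferentiableOn ℂ (fun s => G₁ (s - 1 / 2)) U :=
      (differentiableOn_update_sub_one_mul hS hσ₁).comp (differentiableOn_id.sub (differentiableOn_const _))
        fun s hs => (hre s hs).1
    have h2 : DifferentiableOn ℂ (fun s => G₂ (s + 1 / 2)) U :=
      (differentiableOn_dedekindZetaCont_mul_thinEulerFactor hS).comp
        (differentiableOn_id.add (differentiableOn_const _)) fun s hs => ⟨(hre s hs).2.1, fun h => by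
          have h' : (s + 1 / 2 : ℂ) = 1 := h
          have := (hre s hs).2.2.1
          rw [h', one_re] at this
          exact lt_irrefl _ this⟩
    have h3 : DifferentiableOn ℂ G₃ U :=
      (differentiableOn_partialStandardL_singleton c hc).mono fun s hs => (hre s hs).2.2.2
    exact (h1.mul h2).mul h3
  · -- the value at `3/2`
    have h32 : ((3 / 2 : ℂ) - 1 / 2) = 1 := by norm_num
    have h32' : ((3 / 2 : ℂ) + 1 / 2) = 2 := by norm_num
    have hG₁v : G₁ ((3 / 2 : ℂ) - 1 / 2) = r := by rw [h32, hG₁, Function.update_self]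
    show G₁ ((3 / 2 : ℂ) - 1 / 2) * G₂ ((3 / 2 : ℂ) + 1 / 2) * G₃ (3 / 2) ≠ 0
    rw [hG₁v, h32']
    refine mul_ne_zero (mul_ne_zero (residue_mul_thinEulerFactor_ne_zero hS hσ₁) ?_) ?_
    · exact dedekindZetaCont_mul_thinEulerFactor_ne_zero_of_one_lt_re hS hσ₁ (by norm_num)
    · exact (hasProd_partialStandardL_singleton c hc (s := 3 / 2) (by norm_num)).2
  · -- the identity on `re s > 3/2`
    intro s hs
    have hs1 : 1 < (s - 1 / 2).re := by rw [(re_sub_half_re_add_half s).1]; linarith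
    have hs2 : 1 < (s + 1 / 2).re := by rw [(re_sub_half_re_add_half s).2]; linarith
    have hne : (s - 1 / 2 : ℂ) ≠ 1 := fun h => by
      have := hs1; rw [h, one_re] at this; exact lt_irrefl _ this
    have hG₁s : G₁ (s - 1 / 2) = ((s - 1 / 2) - 1) * (dedekindZetaCont K (s - 1 / 2) *
        ∏' v : S, (1 - ((v : HeightOneSpectrum (𝓞 K)).residueCard : ℂ) ^ (-(s - 1 / 2)))) := by
      rw [hG₁, Function.update_of_ne hne]
    show (s - 3 / 2) * partialStandardL S α s = G₁ (s - 1 / 2) * G₂ (s + 1 / 2) * G₃ s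
    rw [thetaPartialL_eq_mul hc hα hs, hG₁s, hG₂, hG₃,
      partialDedekindZeta_eq_dedekindZetaCont_mul hS hs1 (by linarith),
      partialDedekindZeta_eq_dedekindZetaCont_mul hS hs2 (by linarith)]
    ring

/-- **The pole in `Tendsto` form**: `(s − 3/2) · L^S(s, α) → r ≠ 0` as `s → 3/2` inside `re s > 3/2`, with
`r = ρ_K · E_S(1) · ζ_K^S(2) · L^S(3/2, c)` (the `G(3/2)` of the previous theorem). [folklore] -/
theorem tendsto_sub_mul_thetaPartialL
    (hS : Summable fun v : S => ((v : HeightOneSpectrum (𝓞 K)).residueCard : ℝ) ^ (-σ₀))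
    (hσ₀ : 1 / 2 ≤ σ₀) (hσ₁ : σ₀ < 1) (hc : ∀ v, v ∉ S → ‖c v‖ ≤ 1)
    (hα : ∀ v, v ∉ S → α v = {((Real.sqrt v.residueCard : ℝ) : ℂ), ((Real.sqrt v.residueCard : ℝ) : ℂ)⁻¹, c v}) :
    ∃ r : ℂ, r ≠ 0 ∧ Tendsto (fun s : ℂ => (s - 3 / 2) * partialStandardL S α s)
      (𝓝[{s : ℂ | 3 / 2 < s.re}] (3 / 2)) (𝓝 r) := by
  obtain ⟨G, hGd, hG0, hGeq⟩ := exists_differentiableOn_sub_mul_thetaPartialL_eq hS hσ₀ hσ₁ hc hα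
  refine ⟨G (3 / 2), hG0, ?_⟩
  have hmem : (3 / 2 : ℂ) ∈ {s : ℂ | σ₀ + 1 / 2 < s.re} := by
    show σ₀ + 1 / 2 < (3 / 2 : ℂ).re
    norm_num; linarith
  have hcont : ContinuousAt G (3 / 2) :=
    (hGd.differentiableAt ((isOpen_lt continuous_const continuous_re).mem_nhds hmem)).continuousAt
  refine (hcont.tendsto.mono_left nhdsWithin_le_nhds).congr' ?_
  exact eventually_nhdsWithin_of_forall fun s hs => (hGeq s hs).symm

end Pole

end Summit.HodgeConjecture.HodgeConjecture.Cruxes.H413.F0P2wThetaPartialLPole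

end
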